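import Mathlib
import Summits.ResolutionOfSingularities.ResolutionOfSingularities.Theorems.WeightedInvariantLocalWeightedDropMonicDescentStrategy
import Summits.ResolutionOfSingularities.ResolutionOfSingularities.Theorems.WeightedInvariantGlobalizeLocalDropCylinder

/-!
# `WeightedInvariant.LocalWeightedDrop`, sub-stub N4″: a monic double point scaled from a label REPRESENTS the label (piece T-6′, part B)

Crux item stmt-ResolutionOfSingularities-8899 `LocalWeightedDrop` (route `ResolutionOfSingularities/WeightedInvariant`), door
`WeightedConstruction` stmt-ResolutionOfSingularities-0571.  [OURS · L1 W4.3, chain w43, lead prover; part B of piece T-6′ (`monicDescentBridge`) of `N4PRIME-PLAN.md` §11.]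

`represents_pos_scale`: if `A₀ = e²·L₀(a u₁, b u₂)` and `A₁ = e·L₁(a u₁, b u₂)` with `a, b, e ≠ 0`, then `pos A₀ A₁ = z² + A₁z + A₀` REPRESENTS the label
`(L₀, L₁)` (`MonicDescent.Represents`): the diagonal coordinate change `θ = (a⁻¹ s, b⁻¹ y, e z)` gives `θ^*(pos A) = e² · pos L`.  This is the renormalisation of the
point-move slices `(c₀^{2−j}·(blowOne B_j)(c₀ s, y/c₀))` and of the curve-move slices `(c^{2−j}·(divOne B_j)(c s, y))` of the descent game.
-/

set_option linter.dupNamespace false -- mandated namespace of this single-conjunct summit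

noncomputable section

namespace Summit.ResolutionOfSingularities.ResolutionOfSingularities.Theorems

namespace MonicDescent

open MvPowerSeries Literature.AlgebraicGeometry.Resolution

variable {k : Type} [Field k]

/-- The diagonal scaling `u₁ ↦ a u₁`, `u₂ ↦ b u₂` of the label variables. -/
def scale2 (a b : k) : Fin 2 → MvPowerSeries (Fin 2) k := ![C a * X 0, C b * X 1]

/-- `scale2` has zero constant terms. -/
theorem constantCoeff_scale2 (a b : k) : ∀ i, constantCoeff (scale2 a b i) = 0 := by
  intro i; fin_cases i <;> simp [scale2, constantCoeff_X]

/-- The diagonal coordinate change `(a⁻¹ s, b⁻¹ y, e z)` of the three game variables. -/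
def scale3 (a b e : k) : Fin 3 → MvPowerSeries (Fin 3) k := ![C a⁻¹ * X 0, C b⁻¹ * X 1, C e * X 2]

/-- `scale3` has zero constant terms. -/
theorem constantCoeff_scale3 (a b e : k) : ∀ i, constantCoeff (scale3 a b e i) = 0 := by
  intro i; fin_cases i <;> simp [scale3, constantCoeff_X]

/-- The linear part of `scale3` is the diagonal matrix `(a⁻¹, b⁻¹, e)`. -/
theorem linMat_scale3 (a b e : k) : FormalCoordChange.linMat (scale3 a b e) = Matrix.diagonal ![a⁻¹, b⁻¹, e] := by
  ext i j
  rw [FormalCoordChange.linMat, Matrix.of_apply, Matrix.diagonal_apply]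
  fin_cases i <;> fin_cases j <;> simp [scale3, coeff_index_single_X]

/-- Undoing the base scaling inside the game variables: `scale3 ∘ (embedding of the base) ∘ scale2 = the base embedding`. -/
theorem subst_scale3_rename_subst_scale2 {a b : k} (ha : a ≠ 0) (hb : b ≠ 0) (e : k) (L : MvPowerSeries (Fin 2) k) :
    subst (scale3 a b e) (rename (Fin.succAboveEmb (Fin.last 2)) (subst (scale2 a b) L)) =
      rename (Fin.succAboveEmb (Fin.last 2)) L := by
  have h3 := constantCoeff_scale3 a b e
  have h3s : HasSubst (scale3 a b e) := hasSubst_of_constantCoeff_zero h3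
  have h2s : HasSubst (scale2 a b) := hasSubst_of_constantCoeff_zero (constantCoeff_scale2 a b)
  have hcomp : HasSubst (fun i : Fin 2 => scale3 a b e (Fin.succAboveEmb (Fin.last 2) i)) :=
    hasSubst_of_constantCoeff_zero fun i => h3 _
  rw [subst_rename_eq _ _ h3, subst_comp_subst_apply h2s hcomp, rename_eq_subst]
  congr 1
  funext i
  have h0 : (Fin.succAboveEmb (Fin.last 2)) (0 : Fin 2) = (0 : Fin 3) := rfl
  have h1 : (Fin.succAboveEmb (Fin.last 2)) (1 : Fin 2) = (1 : Fin 3) := rfl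
  fin_cases i
  · show subst _ (C a * X 0) = X ((Fin.succAboveEmb (Fin.last 2)) 0)
    rw [← smul_eq_C_mul, subst_smul hcomp, subst_X hcomp, h0]
    show a • scale3 a b e 0 = X 0
    simp only [scale3, Matrix.cons_val_zero]
    rw [smul_eq_C_mul, ← mul_assoc, ← map_mul, mul_inv_cancel₀ ha, map_one, one_mul]
  · show subst _ (C b * X 1) = X ((Fin.succAboveEmb (Fin.last 2)) 1)
    rw [← smul_eq_C_mul, subst_smul hcomp, subst_X hcomp, h1]
    show b • scale3 a b e 1 = X 1
    simp only [scale3, Matrix.cons_val_one, Matrix.cons_val_zero]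
    rw [smul_eq_C_mul, ← mul_assoc, ← map_mul, mul_inv_cancel₀ hb, map_one, one_mul]

/-- REPRESENTATION BY SCALING: `pos (e²·L₀(au₁,bu₂)) (e·L₁(au₁,bu₂))` represents `(L₀, L₁)`. -/
theorem represents_pos_scale (L₀ L₁ : MvPowerSeries (Fin 2) k) {a b e : k} (ha : a ≠ 0) (hb : b ≠ 0) (he : e ≠ 0)
    {A₀ A₁ : MvPowerSeries (Fin 2) k} (h₀ : A₀ = C (e ^ 2) * subst (scale2 a b) L₀) (h₁ : A₁ = C e * subst (scale2 a b) L₁) :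
    Represents (pos A₀ A₁) L₀ L₁ := by
  have h3 := constantCoeff_scale3 a b e
  have h3s : HasSubst (scale3 a b e) := hasSubst_of_constantCoeff_zero h3
  refine ⟨scale3 a b e, C (e ^ 2), h3, ?_, ?_, ?_⟩
  · rw [linMat_scale3, Matrix.det_diagonal]
    refine isUnit_iff_ne_zero.mpr ?_
    simp [Fin.prod_univ_three, ha, hb, he]
  · rw [constantCoeff_C]; exact pow_ne_zero 2 he
  · unfold pos
    have hz : scale3 a b e (Fin.last 2) = C e * X (Fin.last 2) := rfl
    rw [h₀, h₁, map_mul, map_mul, rename_C, rename_C, ← coe_substAlgHom h3s]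
    simp only [map_add, map_mul, map_pow]
    rw [coe_substAlgHom, subst_C, subst_X h3s, hz, subst_scale3_rename_subst_scale2 ha hb e L₀,
      subst_scale3_rename_subst_scale2 ha hb e L₁]
    show _ = _ * (X (Fin.last 2) ^ 2 + (rename (Fin.succAboveEmb (Fin.last 2)) L₀ +
      rename (Fin.succAboveEmb (Fin.last 2)) L₁ * X (Fin.last 2)))
    ring

end MonicDescent

end Summit.ResolutionOfSingularities.ResolutionOfSingularities.Theorems

end
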